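import Summits.NavierStokesRegularity.NavierStokesRegularity.Theorems.ExtremiserTransienceRegularisedNearPlateauStabilitySparseBangBangTestField
import Summits.NavierStokesRegularity.NavierStokesRegularity.Theorems.ExtremiserTransienceRegularisedNearPlateauStabilitySparseBangBangSlackVariation
import Summits.NavierStokesRegularity.NavierStokesRegularity.Theorems.ExtremiserTransienceRegularisedNearPlateauStabilitySparseBangBangCoeffBounds
import Summits.NavierStokesRegularity.NavierStokesRegularity.Theorems.ExtremiserTransienceRegularisedNearPlateauStabilityBangBangCoreStubDensitySupBound
import Summits.NavierStokesRegularity.NavierStokesRegularity.Theorems.ExtremiserTransienceRegularisedNearPlateauStabilityBangBangCoreTools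
import HarnessLib

/-!
# Route `ExtremiserTransience`, crux `RegularisedNearPlateauStability` (stmt-NavierStokesRegularity-28317),
# LINE g8-α «sparse bang-bang»: SPARSE NEAR-PLATEAU STABILITY (S-B) — item 28317 on the sparse class, PROVED

`--supports stmt-NavierStokesRegularity-28317`. Author: prover seat `ns-net-p2` (g2).

`sparseNearPlateauStability` is VERBATIM the statement `SparseNearPlateauStability` (= stub S-B) of
`Cruxes/NearExtremalTransiencePerFlow/Lines/sparse_bangbang.lean` with its abbreviation `IsSparse N₀ v M := W·λ ≤ N₀·M²`
unfolded (the workfile's stub closes by `exact`): for every budget `A` and sparseness level `N₀` there are `c₀, r > 0` such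
that for every `δ > 0` some `ε > 0` works — an admissible, `A`-regular, `N₀`-sparse, non-degenerate, `(κ⋆−ε)`-efficient
field has a ball of radius `rλ` with `vol{‖v‖ ≥ (1−δ)M} ≥ c₀(rλ)³`; i.e. item 28317 RESTRICTED TO THE SPARSE CLASS.
PROOF = the global bang-bang inequality (★): `2κ⋆²M²ZW − slack ≤ |ell_v(curl η)| = |∫⟪G, η⟫| ≤ ‖G‖_∞‖η‖_∞·vol(T)`
with the top test field `η` (`exists_topTestField` ⇒ `abs_ell_add_le_of_shrinking`, sizes via `…CoeffBounds`), K2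
`stub_densitySupBound`, `‖η‖ ≤ Ψ₀Mλ`, the slack killed by `ε(δ)` (`slack_choice`), the cell floor `Wλ ≥ n₀M²`
(`cellNumber_lower`), hence `vol(T) ≥ (κ⋆²n₀/(C_GΨ₀))λ³` δ-uniformly, and a pigeonhole over the `≤ m₀(A₁,N₀)` cluster
balls of radius `≤ ρ₀λ` covering the half-top set (`card_separated_halfTop_le`, `exists_cluster_cover`).
HONEST FRAMING: a theorem about near-maximisers of one scale-invariant functional in a regularity/sparseness class; it says
nothing about Navier–Stokes solutions; 28317 (no sparseness), 26567 and NS regularity remain OPEN; no summit is proved by a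
line. [folklore]
-/

noncomputable section

open Set Filter Topology MeasureTheory Metric
open scoped InnerProductSpace RealInnerProductSpace ENNReal ContDiff
open Literature.Analysis.FluidPDE
open Summit.NavierStokesRegularity.NavierStokesRegularity.Theorems.DepletionLadder.KStar.HalfSpace

namespace Summit.NavierStokesRegularity.NavierStokesRegularity.Theorems

-- the problem directory repeats the summit name (`NavierStokesRegularity/NavierStokesRegularity`)
set_option linter.dupNamespace false

namespace DepletionLadder.KStar.BangBang

variable {v : E3 → E3}

/-! ## Two small tools: the two-sided contact inequality and the pigeonhole -/

/-- Two-sided contact inequality: `|ell_v(curl η)| ≤ Γ·H·vol(T)` when `G` is a density with `‖G‖ ≤ Γ`, `η ∈ C_c^∞`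
vanishes off the measurable finite-volume set `T` and `‖η‖ ≤ H`. [folklore] -/
theorem abs_ell_curl_le_of_density {G η : E3 → E3} {M Γ H : ℝ} (hG : IsDensity v M G) (hΓ : ∀ x, ‖G x‖ ≤ Γ)
    (hη : ContDiff ℝ ∞ η) (hηc : HasCompactSupport η) {T : Set E3} (hT : MeasurableSet T) (hTfin : volume T ≠ ⊤)
    (hηT : ∀ x, x ∉ T → η x = 0) (hH : ∀ x, ‖η x‖ ≤ H) :
    |ell v M (curl η)| ≤ Γ * H * (volume T).toReal := by
  rw [hG.2 η hη hηc]
  have hind : Integrable (T.indicator fun _ => Γ * H) (volume : Measure E3) :=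
    (integrableOn_const (hs := hTfin)).integrable_indicator hT
  have h := norm_integral_le_of_norm_le (f := fun x => ⟪G x, η x⟫_ℝ) hind (Eventually.of_forall fun x => ?_)
  · rw [Real.norm_eq_abs, integral_indicator_const _ hT, smul_eq_mul, Measure.real, mul_comm] at h
    exact h
  · by_cases hx : x ∈ T
    · rw [indicator_of_mem hx, Real.norm_eq_abs]
      calc |⟪G x, η x⟫_ℝ| ≤ ‖G x‖ * ‖η x‖ := abs_real_inner_le_norm _ _
        _ ≤ Γ * H := mul_le_mul (hΓ x) (hH x) (norm_nonneg _) ((norm_nonneg _).trans (hΓ x))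
    · rw [indicator_of_notMem hx, hηT x hx, inner_zero_right, norm_zero]

/-- Pigeonhole over finitely many pieces: if `S ⊆ ⋃ᵢ Pᵢ` (`i < k`, `k ≤ m`) and `(m+1)·b ≤ vol S` for a finite
`b ≠ 0`, then some piece meets `S` in volume `≥ b`. [folklore] -/
theorem exists_piece_volume_ge {k m : ℕ} (hk : k ≤ m) (S : Set E3) (P : Fin k → Set E3) (hcov : S ⊆ ⋃ i, P i)
    (b : ℝ≥0∞) (hb : b ≠ 0) (hb' : b ≠ ⊤) (hm : ((m + 1 : ℕ) : ℝ≥0∞) * b ≤ volume S) :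
    ∃ i, b ≤ volume (S ∩ P i) := by
  by_contra hcon
  simp only [not_exists, not_le] at hcon
  have hS : S = ⋃ i, (S ∩ P i) := by rw [← Set.inter_iUnion]; exact (Set.inter_eq_left.2 hcov).symm
  have hle : volume S ≤ ∑ i : Fin k, volume (S ∩ P i) := by
    conv_lhs => rw [hS]
    exact measure_iUnion_fintype_le volume _
  have hsum : ∑ i : Fin k, volume (S ∩ P i) ≤ ∑ _i : Fin k, b := Finset.sum_le_sum fun i _ => (hcon i).le
  rw [Finset.sum_const, Finset.card_univ, Fintype.card_fin, nsmul_eq_mul] at hsum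
  have hkm : (k : ℝ≥0∞) * b < ((m + 1 : ℕ) : ℝ≥0∞) * b := by
    have h := ENNReal.mul_lt_mul_right hb hb' (show (k : ℝ≥0∞) < ((m + 1 : ℕ) : ℝ≥0∞) by
      exact_mod_cast Nat.lt_succ_of_le hk)
    simpa only [mul_comm] using h
  exact absurd (hm.trans (hle.trans hsum)) (not_le.2 hkm)

/-! ## S-B: sparse near-plateau stability -/

/-- Numerics of the slack: with `b, Λ ≥ 1`, `0 < σ₀`, and
`ε = min (κ/2) (min (κ²/(48bΛ²))² (κ²σ₀/(48bΛ²)))` (`κ > 0`): `0 < ε`, `ε ≤ κ/2` and `24bΛ²(√ε + ε/σ₀) ≤ κ²`. [folklore] -/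
theorem slack_choice {κ b Λ σ₀ : ℝ} (hκ : 0 < κ) (hb : 1 ≤ b) (hΛ : 1 ≤ Λ) (hσ₀ : 0 < σ₀) :
    0 < min (κ / 2) (min ((κ ^ 2 / (48 * b * Λ ^ 2)) ^ 2) (κ ^ 2 * σ₀ / (48 * b * Λ ^ 2))) ∧
    min (κ / 2) (min ((κ ^ 2 / (48 * b * Λ ^ 2)) ^ 2) (κ ^ 2 * σ₀ / (48 * b * Λ ^ 2))) ≤ κ / 2 ∧
    24 * b * Λ ^ 2 * (Real.sqrt (min (κ / 2) (min ((κ ^ 2 / (48 * b * Λ ^ 2)) ^ 2) (κ ^ 2 * σ₀ / (48 * b * Λ ^ 2)))) +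
      min (κ / 2) (min ((κ ^ 2 / (48 * b * Λ ^ 2)) ^ 2) (κ ^ 2 * σ₀ / (48 * b * Λ ^ 2))) / σ₀) ≤ κ ^ 2 := by
  set D : ℝ := 48 * b * Λ ^ 2 with hD
  have hD0 : 0 < D := by rw [hD]; positivity
  set e₁ : ℝ := κ ^ 2 / D with he₁
  have he₁0 : 0 < e₁ := by rw [he₁]; positivity
  set ε : ℝ := min (κ / 2) (min (e₁ ^ 2) (κ ^ 2 * σ₀ / D)) with hε
  have hε0 : 0 < ε := lt_min (by positivity) (lt_min (by positivity) (by positivity))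
  refine ⟨hε0, min_le_left _ _, ?_⟩
  have h1 : Real.sqrt ε ≤ e₁ := by
    calc Real.sqrt ε ≤ Real.sqrt (e₁ ^ 2) := Real.sqrt_le_sqrt ((min_le_right _ _).trans (min_le_left _ _))
      _ = e₁ := Real.sqrt_sq he₁0.le
  have h2 : ε / σ₀ ≤ κ ^ 2 / D := by
    rw [div_le_iff₀ hσ₀]
    have hεle : ε ≤ κ ^ 2 * σ₀ / D := by
      rw [hε]; exact (min_le_right _ _).trans (min_le_right _ _)
    calc ε ≤ κ ^ 2 * σ₀ / D := hεle
      _ = κ ^ 2 / D * σ₀ := by ring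
  have hsum : Real.sqrt ε + ε / σ₀ ≤ 2 * (κ ^ 2 / D) := by rw [he₁] at h1; linarith
  calc 24 * b * Λ ^ 2 * (Real.sqrt ε + ε / σ₀) ≤ 24 * b * Λ ^ 2 * (2 * (κ ^ 2 / D)) :=
        mul_le_mul_of_nonneg_left hsum (by positivity)
    _ = κ ^ 2 := by rw [hD]; field_simp; norm_num

/-- The coefficient sizes of the shrinking sextic for the direction `φ = curl η` in the sparse bang-bang setting:
`‖Dv‖ ≤ A₁M/λ`, `‖Dφ‖ ≤ ΛM/λ`, `Z(φ) ≤ Λ²Z`, `Z = λ²W` give `|J₁(v;φ)|, |J₁(φ;v)|, |J(φ)| ≤ (2A₁+3)Λ³·M√Z√W` and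
`|a₁| ≤ ΛZ`, `|c₁| ≤ ΛW`. [folklore] -/
theorem coeff_sizes {φ : E3 → E3} {M B A₁ Λ : ℝ} (hadm : IsAdm v M B) (hφ : ContDiff ℝ ∞ φ)
    (hφc : HasCompactSupport φ) (hA₁ : 1 ≤ A₁) (hΛ : 1 ≤ Λ) (hlam : 0 < lam v) (hZeq : Zen v = lam v ^ 2 * Wpa v)
    (hLv : ∀ x, ‖fderiv ℝ v x‖ ≤ A₁ * M * (lam v)⁻¹) (hLφ : ∀ x, ‖fderiv ℝ φ x‖ ≤ Λ * M * (lam v)⁻¹)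
    (hZφ : Zen φ ≤ Λ ^ 2 * Zen v) (hWφ : Wpa φ ≤ Λ ^ 2 * Wpa v) :
    |J1 v φ| ≤ (2 * A₁ + 3) * Λ ^ 3 * (M * Real.sqrt (Zen v) * Real.sqrt (Wpa v)) ∧
    |J1 φ v| ≤ (2 * A₁ + 3) * Λ ^ 3 * (M * Real.sqrt (Zen v) * Real.sqrt (Wpa v)) ∧
    |Jst φ| ≤ (2 * A₁ + 3) * Λ ^ 3 * (M * Real.sqrt (Zen v) * Real.sqrt (Wpa v)) ∧
    |A1 v φ| ≤ Λ * Zen v ∧ |C1 v φ| ≤ Λ * Wpa v := by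
  obtain ⟨hv, -, hM, -, -, h1, h2⟩ := hadm
  have hM0 : 0 ≤ M := (norm_nonneg _).trans (hM 0)
  have hZ0 : 0 ≤ Zen v := integral_nonneg fun x => by positivity
  have hW0 : 0 ≤ Wpa v := integral_nonneg fun x => frobeniusNormSq_nonneg _
  have hZφ0 : 0 ≤ Zen φ := integral_nonneg fun x => by positivity
  have hΛ0 : 0 ≤ Λ := le_trans zero_le_one hΛ
  have hA0 : 0 ≤ A₁ := le_trans zero_le_one hA₁
  -- `√Z(φ) ≤ Λ √Z`, `√W(φ) ≤ Λ √W`, `U = M λ W`, `M λ⁻¹ Z = U`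
  have hsZφ : Real.sqrt (Zen φ) ≤ Λ * Real.sqrt (Zen v) := by
    calc Real.sqrt (Zen φ) ≤ Real.sqrt (Λ ^ 2 * Zen v) := Real.sqrt_le_sqrt hZφ
      _ = Λ * Real.sqrt (Zen v) := by rw [Real.sqrt_mul (sq_nonneg _), Real.sqrt_sq hΛ0]
  have hsWφ : Real.sqrt (Wpa φ) ≤ Λ * Real.sqrt (Wpa v) := by
    calc Real.sqrt (Wpa φ) ≤ Real.sqrt (Λ ^ 2 * Wpa v) := Real.sqrt_le_sqrt hWφ
      _ = Λ * Real.sqrt (Wpa v) := by rw [Real.sqrt_mul (sq_nonneg _), Real.sqrt_sq hΛ0]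
  set U : ℝ := M * Real.sqrt (Zen v) * Real.sqrt (Wpa v) with hUdef
  have hsZ : Real.sqrt (Zen v) = lam v * Real.sqrt (Wpa v) := by
    rw [hZeq, Real.sqrt_mul (sq_nonneg _), Real.sqrt_sq hlam.le]
  have hWW : Real.sqrt (Wpa v) * Real.sqrt (Wpa v) = Wpa v := Real.mul_self_sqrt hW0
  have hU : M * (lam v)⁻¹ * Zen v = U := by
    have hl : lam v ≠ 0 := hlam.ne'
    calc M * (lam v)⁻¹ * Zen v = M * ((lam v)⁻¹ * lam v) * lam v * Wpa v := by rw [hZeq]; ring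
      _ = M * lam v * Wpa v := by rw [inv_mul_cancel₀ hl, mul_one]
      _ = M * (lam v * Real.sqrt (Wpa v)) * Real.sqrt (Wpa v) := by
          rw [show M * (lam v * Real.sqrt (Wpa v)) * Real.sqrt (Wpa v) =
            M * lam v * (Real.sqrt (Wpa v) * Real.sqrt (Wpa v)) by ring, hWW]
      _ = U := by rw [hUdef, hsZ]
  have hU0 : 0 ≤ U := by rw [hUdef]; positivity
  have hZU : M * (lam v)⁻¹ * (Real.sqrt (Zen v) * Real.sqrt (Zen v)) = U := by rw [Real.mul_self_sqrt hZ0, hU]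
  have hJ1 := abs_J1_le hv hLv h1 hφ hφc hLφ; have hJ2 := abs_J1_swap_le hv hLv h1 hφ hφc hLφ
  have hJ3 := abs_Jst_le hφ hφc hLφ; have hA1 := abs_A1_le hv h1 hφ hφc; have hC1 := abs_C1_le hv h2 hφ hφc
  have hΛ2 : Λ ≤ Λ ^ 2 := le_self_pow₀ hΛ two_ne_zero; have hΛ3 : Λ ^ 2 ≤ Λ ^ 3 := pow_le_pow_right₀ hΛ (by norm_num)
  refine ⟨?_, ?_, ?_, ?_, ?_⟩
  · -- `2 A₁ M λ⁻¹ √Z √Zφ + Λ M λ⁻¹ Z ≤ (2A₁ + 1) Λ U`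
    have e1 : 2 * (A₁ * M * (lam v)⁻¹) * Real.sqrt (Zen v) * Real.sqrt (Zen φ) ≤ 2 * A₁ * Λ * U := by
      calc 2 * (A₁ * M * (lam v)⁻¹) * Real.sqrt (Zen v) * Real.sqrt (Zen φ)
          ≤ 2 * (A₁ * M * (lam v)⁻¹) * Real.sqrt (Zen v) * (Λ * Real.sqrt (Zen v)) :=
            mul_le_mul_of_nonneg_left hsZφ (by positivity)
        _ = 2 * A₁ * Λ * (M * (lam v)⁻¹ * (Real.sqrt (Zen v) * Real.sqrt (Zen v))) := by ring
        _ = 2 * A₁ * Λ * U := by rw [hZU]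
    have e2 : Λ * M * (lam v)⁻¹ * Zen v = Λ * U := by rw [← hU]; ring
    calc |J1 v φ| ≤ 2 * (A₁ * M * (lam v)⁻¹) * Real.sqrt (Zen v) * Real.sqrt (Zen φ) + Λ * M * (lam v)⁻¹ * Zen v := hJ1
      _ ≤ 2 * A₁ * Λ * U + Λ * U := by rw [e2]; linarith
      _ = (2 * A₁ + 1) * Λ * U := by ring
      _ ≤ (2 * A₁ + 3) * Λ ^ 3 * U := by
          have : (2 * A₁ + 1) * Λ ≤ (2 * A₁ + 3) * Λ ^ 3 := by nlinarith
          exact mul_le_mul_of_nonneg_right this hU0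
  · have e1 : 2 * (Λ * M * (lam v)⁻¹) * Real.sqrt (Zen v) * Real.sqrt (Zen φ) ≤ 2 * Λ ^ 2 * U := by
      calc 2 * (Λ * M * (lam v)⁻¹) * Real.sqrt (Zen v) * Real.sqrt (Zen φ)
          ≤ 2 * (Λ * M * (lam v)⁻¹) * Real.sqrt (Zen v) * (Λ * Real.sqrt (Zen v)) :=
            mul_le_mul_of_nonneg_left hsZφ (by positivity)
        _ = 2 * Λ ^ 2 * (M * (lam v)⁻¹ * (Real.sqrt (Zen v) * Real.sqrt (Zen v))) := by ring
        _ = 2 * Λ ^ 2 * U := by rw [hZU]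
    have e2 : A₁ * M * (lam v)⁻¹ * Zen φ ≤ A₁ * Λ ^ 2 * U := by
      calc A₁ * M * (lam v)⁻¹ * Zen φ ≤ A₁ * M * (lam v)⁻¹ * (Λ ^ 2 * Zen v) :=
            mul_le_mul_of_nonneg_left hZφ (by positivity)
        _ = A₁ * Λ ^ 2 * (M * (lam v)⁻¹ * Zen v) := by ring
        _ = A₁ * Λ ^ 2 * U := by rw [hU]
    calc |J1 φ v| ≤ 2 * (Λ * M * (lam v)⁻¹) * Real.sqrt (Zen v) * Real.sqrt (Zen φ) + A₁ * M * (lam v)⁻¹ * Zen φ := hJ2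
      _ ≤ 2 * Λ ^ 2 * U + A₁ * Λ ^ 2 * U := add_le_add e1 e2
      _ = (A₁ + 2) * Λ ^ 2 * U := by ring
      _ ≤ (2 * A₁ + 3) * Λ ^ 3 * U := by
          have : (A₁ + 2) * Λ ^ 2 ≤ (2 * A₁ + 3) * Λ ^ 3 := by nlinarith
          exact mul_le_mul_of_nonneg_right this hU0
  · calc |Jst φ| ≤ Λ * M * (lam v)⁻¹ * Zen φ := hJ3
      _ ≤ Λ * M * (lam v)⁻¹ * (Λ ^ 2 * Zen v) := mul_le_mul_of_nonneg_left hZφ (by positivity)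
      _ = Λ ^ 3 * (M * (lam v)⁻¹ * Zen v) := by ring
      _ = Λ ^ 3 * U := by rw [hU]
      _ ≤ (2 * A₁ + 3) * Λ ^ 3 * U := by
          have : Λ ^ 3 ≤ (2 * A₁ + 3) * Λ ^ 3 := by nlinarith [pow_nonneg hΛ0 3]
          exact mul_le_mul_of_nonneg_right this hU0
  · calc |A1 v φ| ≤ Real.sqrt (Zen v) * Real.sqrt (Zen φ) := hA1
      _ ≤ Real.sqrt (Zen v) * (Λ * Real.sqrt (Zen v)) := mul_le_mul_of_nonneg_left hsZφ (Real.sqrt_nonneg _)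
      _ = Λ * Zen v := by rw [← mul_assoc, mul_comm (Real.sqrt _) Λ, mul_assoc, Real.mul_self_sqrt hZ0]
  · calc |C1 v φ| ≤ Real.sqrt (Wpa v) * Real.sqrt (Wpa φ) := hC1
      _ ≤ Real.sqrt (Wpa v) * (Λ * Real.sqrt (Wpa v)) := mul_le_mul_of_nonneg_left hsWφ (Real.sqrt_nonneg _)
      _ = Λ * Wpa v := by rw [← mul_assoc, mul_comm (Real.sqrt _) Λ, mul_assoc, Real.mul_self_sqrt hW0]

/-- Cell-number floor at deficit `ε ≤ κ⋆/2`: `π·M²/(16(‖curlCLM‖+1)A₁) ≤ W·λ` (from `cellNumber_lower`). [folklore] -/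
theorem cell_floor {A : ℕ → ℝ} {M B ε : ℝ} (hA1 : 1 ≤ A 1) (hadm : IsAdm v M B) (hreg : IsReg A v M)
    (hpos : 0 < M * Real.sqrt (Zen v) * Real.sqrt (Wpa v)) (hε : ε ≤ kStar / 2)
    (heff : (kStar - ε) * M * Real.sqrt (Zen v) * Real.sqrt (Wpa v) ≤ |Jst v|) :
    Real.pi / (16 * (‖curlCLM‖ + 1) * A 1) * M ^ 2 ≤ Wpa v * lam v := by
  have hk : 0 < kStar := kStar_pos
  have h := cellNumber_lower hadm hreg hpos (by linarith) heff
  have hc0 : 0 ≤ ‖curlCLM‖ := norm_nonneg curlCLM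
  have hWl : 0 ≤ Wpa v * lam v :=
    mul_nonneg (integral_nonneg fun x => frobeniusNormSq_nonneg _) (Real.sqrt_nonneg _)
  have hcube : kStar ^ 3 / 8 ≤ (kStar - ε) ^ 3 := by
    have h1 : kStar / 2 ≤ kStar - ε := by linarith
    have h2 := pow_le_pow_left₀ (by linarith) h1 3
    calc kStar ^ 3 / 8 = (kStar / 2) ^ 3 := by ring
      _ ≤ (kStar - ε) ^ 3 := h2
  have h3 : Real.pi * (kStar ^ 3 / 8) * M ^ 2 ≤ 2 * kStar ^ 3 * (‖curlCLM‖ + 1) * A 1 * (Wpa v * lam v) := by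
    have e1 : Real.pi * (kStar ^ 3 / 8) * M ^ 2 ≤ Real.pi * (kStar - ε) ^ 3 * M ^ 2 := by
      have := mul_le_mul_of_nonneg_left hcube Real.pi_pos.le
      exact mul_le_mul_of_nonneg_right this (sq_nonneg M)
    have e2 : 2 * kStar ^ 3 * ‖curlCLM‖ * A 1 * (Wpa v * lam v) ≤
        2 * kStar ^ 3 * (‖curlCLM‖ + 1) * A 1 * (Wpa v * lam v) := by
      have : 0 ≤ 2 * kStar ^ 3 * A 1 * (Wpa v * lam v) := by positivity
      nlinarith
    exact e1.trans (h.trans e2)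
  have hden : 0 < 16 * (‖curlCLM‖ + 1) * A 1 := by positivity
  rw [div_mul_eq_mul_div, div_le_iff₀ hden]
  have hk3 : 0 < kStar ^ 3 := pow_pos hk 3
  nlinarith [hk3, mul_nonneg hWl (by positivity : (0:ℝ) ≤ (‖curlCLM‖ + 1) * A 1)]

/-- **The near-top volume bound (★) for one field**: with a top test field `η`, a density `G` and a small deficit,
`κ⋆²·n₀/(C_G·Ψ₀)·λ³ ≤ vol{‖v‖ ≥ (1−3δ'/4)M}`. [folklore] -/
theorem topVolume_lower_of_testField {η G : E3 → E3} {M B A₁ Λ σ₀ ε C_G Ψ₀ n₀ δ' : ℝ}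
    (hadm : IsAdm v M B) (hA₁ : 1 ≤ A₁) (hLv1 : ∀ x, ‖iteratedFDeriv ℝ 1 v x‖ ≤ A₁ * M * (lam v)⁻¹)
    (hpos : 0 < M * Real.sqrt (Zen v) * Real.sqrt (Wpa v)) (hε0 : 0 ≤ ε) (hεk : ε ≤ kStar)
    (heff : (kStar - ε) * M * Real.sqrt (Zen v) * Real.sqrt (Wpa v) ≤ |Jst v|)
    (hΛ : 1 ≤ Λ) (hσ₀ : 0 < σ₀) (hσ₁ : σ₀ ≤ 1)
    (hslack : 24 * ((2 * A₁ + 3) * Λ ^ 3) * Λ ^ 2 * (Real.sqrt ε + ε / σ₀) ≤ kStar ^ 2)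
    (hη : ContDiff ℝ ∞ η) (hηc : HasCompactSupport η) (hsupp : ∀ x, η x ≠ 0 → (1 - 3 * δ' / 4) * M ≤ ‖v x‖)
    (hsup : ∀ x, ‖η x‖ ≤ Ψ₀ * M * lam v) (hΨ₀ : 0 < Ψ₀)
    (hshrink : ∀ σ : ℝ, |σ| ≤ σ₀ → ∀ x, ‖v x + σ • curl η x‖ ≤ (1 - σ) * M)
    (hDφ : ∀ x, ‖fderiv ℝ (curl η) x‖ ≤ Λ * M * (lam v)⁻¹) (hZφ : Zen (curl η) ≤ Λ ^ 2 * Zen v)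
    (hWφ : Wpa (curl η) ≤ Λ ^ 2 * Wpa v) (hGd : IsDensity v M G) (hCG : 0 < C_G)
    (hGsup : ∀ x, ‖G x‖ ≤ C_G * M ^ 3 * Wpa v * (lam v)⁻¹ ^ 3) (hlow : n₀ * M ^ 2 ≤ Wpa v * lam v)
    (hTfin : volume {x : E3 | (1 - 3 * δ' / 4) * M ≤ ‖v x‖} ≠ ⊤) :
    kStar ^ 2 * n₀ / (C_G * Ψ₀) * lam v ^ 3 ≤ (volume {x : E3 | (1 - 3 * δ' / 4) * M ≤ ‖v x‖}).toReal := by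
  have hadm' := hadm
  obtain ⟨hv, hdiv, hM, hB, h0, h1, h2⟩ := hadm
  -- non-degeneracy
  have hZ0 : 0 ≤ Zen v := integral_nonneg fun x => by positivity
  have hW0 : 0 ≤ Wpa v := integral_nonneg fun x => frobeniusNormSq_nonneg _
  have hMpos : 0 < M := by
    by_contra h
    exact absurd hpos (not_lt.2 (mul_nonpos_of_nonpos_of_nonneg
      (mul_nonpos_of_nonpos_of_nonneg (not_lt.1 h) (Real.sqrt_nonneg _)) (Real.sqrt_nonneg _)))
  have hsZpos : 0 < Real.sqrt (Zen v) := lt_of_le_of_ne (Real.sqrt_nonneg _) fun h => by rw [← h] at hpos; simp at hpos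
  have hsWpos : 0 < Real.sqrt (Wpa v) := lt_of_le_of_ne (Real.sqrt_nonneg _) fun h => by rw [← h] at hpos; simp at hpos
  have hZpos : 0 < Zen v := Real.sqrt_pos.1 hsZpos; have hWpos : 0 < Wpa v := Real.sqrt_pos.1 hsWpos
  have hlampos : 0 < lam v := Real.sqrt_pos.2 (div_pos hZpos hWpos)
  have hZeq : Zen v = lam v ^ 2 * Wpa v := by
    have h := Real.sq_sqrt (div_nonneg hZ0 hW0)
    rw [show Real.sqrt (Zen v / Wpa v) = lam v from rfl] at h
    rw [h, div_mul_cancel₀ _ hWpos.ne']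
  -- the direction `φ = curl η` and its sizes
  have hφ : ContDiff ℝ ∞ (curl η) := contDiff_curl_top hη
  have hφc : HasCompactSupport (curl η) := hasCompactSupport_curl hηc
  have hφdiv : VectorCalculus.IsDivFree (curl η) := fun x =>
    divergence_curl_eq_zero_holds _ (hη.of_le (by norm_cast)) x
  have hLv : ∀ x, ‖fderiv ℝ v x‖ ≤ A₁ * M * (lam v)⁻¹ := fun x => by
    rw [← norm_iteratedFDeriv_zero (𝕜 := ℝ) (f := fderiv ℝ v), norm_iteratedFDeriv_fderiv]; exact hLv1 x
  obtain ⟨hJ1, hJ2, hJ3, ha1, hc1⟩ := coeff_sizes hadm' hφ hφc hA₁ hΛ hlampos hZeq hLv hDφ hZφ hWφ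
  have hΛ0 : 0 ≤ Λ := le_trans zero_le_one hΛ
  have hb1 : 1 ≤ (2 * A₁ + 3) * Λ ^ 3 := by nlinarith [one_le_pow₀ (n := 3) hΛ]
  have hkey := abs_ell_add_le_of_shrinking hadm' hφ hφc hφdiv hσ₀ hσ₁ hshrink hε0 hεk heff hb1 hΛ hJ1 hJ2 hJ3
    ha1 hZφ hc1 hWφ
  have hU2 : 0 ≤ M ^ 2 * Zen v * Wpa v := by positivity
  have hlowbd : kStar ^ 2 * (M ^ 2 * Zen v * Wpa v) ≤ |ell v M (curl η)| := by
    have h1' := (abs_le.1 hkey).2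
    have h2' : 24 * ((2 * A₁ + 3) * Λ ^ 3) * Λ ^ 2 * (Real.sqrt ε + ε / σ₀) * (M ^ 2 * Zen v * Wpa v) ≤
        kStar ^ 2 * (M ^ 2 * Zen v * Wpa v) := mul_le_mul_of_nonneg_right hslack hU2
    have h3' : ell v M (curl η) ≤ -(kStar ^ 2 * (M ^ 2 * Zen v * Wpa v)) := by linarith
    calc kStar ^ 2 * (M ^ 2 * Zen v * Wpa v) ≤ -ell v M (curl η) := by linarith
      _ ≤ |ell v M (curl η)| := neg_le_abs _
  -- the contact inequality
  have hTm : MeasurableSet {x : E3 | (1 - 3 * δ' / 4) * M ≤ ‖v x‖} :=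
    (isClosed_le continuous_const (continuous_norm.comp hv.continuous)).measurableSet
  have hηT : ∀ x, x ∉ {x : E3 | (1 - 3 * δ' / 4) * M ≤ ‖v x‖} → η x = 0 := fun x hx => by
    by_contra h; exact hx (hsupp x h)
  have hcontact := abs_ell_curl_le_of_density hGd hGsup hη hηc hTm hTfin hηT hsup
  set V : ℝ := (volume {x : E3 | (1 - 3 * δ' / 4) * M ≤ ‖v x‖}).toReal with hVdef
  have hV0 : 0 ≤ V := ENNReal.toReal_nonneg
  have hchain : kStar ^ 2 * (M ^ 2 * Zen v * Wpa v) ≤ C_G * M ^ 3 * Wpa v * (lam v)⁻¹ ^ 3 * (Ψ₀ * M * lam v) * V :=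
    hlowbd.trans hcontact
  -- algebra: `κ² λ⁴ W ≤ C_G Ψ₀ M² V`, then the cell floor
  have hl : lam v ≠ 0 := hlampos.ne'
  have h4 : kStar ^ 2 * lam v ^ 4 * Wpa v ≤ C_G * Ψ₀ * M ^ 2 * V := by
    rw [hZeq] at hchain
    have e : C_G * M ^ 3 * Wpa v * (lam v)⁻¹ ^ 3 * (Ψ₀ * M * lam v) * V =
        (C_G * Ψ₀ * M ^ 2 * V) * (M ^ 2 * Wpa v * (lam v)⁻¹ ^ 2) := by field_simp
    have e' : kStar ^ 2 * (M ^ 2 * (lam v ^ 2 * Wpa v) * Wpa v) =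
        (kStar ^ 2 * lam v ^ 4 * Wpa v) * (M ^ 2 * Wpa v * (lam v)⁻¹ ^ 2) := by field_simp
    rw [e, e'] at hchain
    exact le_of_mul_le_mul_right hchain (by positivity)
  have h5 : kStar ^ 2 * n₀ * lam v ^ 3 ≤ C_G * Ψ₀ * V := by
    have e1 : kStar ^ 2 * n₀ * lam v ^ 3 * M ^ 2 ≤ kStar ^ 2 * lam v ^ 4 * Wpa v := by
      have := mul_le_mul_of_nonneg_left hlow (by positivity : 0 ≤ kStar ^ 2 * lam v ^ 3)
      nlinarith
    have e2 := e1.trans h4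
    rw [show C_G * Ψ₀ * M ^ 2 * V = (C_G * Ψ₀ * V) * M ^ 2 by ring] at e2
    exact le_of_mul_le_mul_right e2 (by positivity)
  rw [div_mul_eq_mul_div, div_le_iff₀ (by positivity)]
  linarith

/-- **S-B — SPARSE NEAR-PLATEAU STABILITY** (statement `SparseNearPlateauStability` of
`Cruxes/NearExtremalTransiencePerFlow/Lines/sparse_bangbang.lean`, `IsSparse` unfolded): item 28317 on the sparse class.
[folklore] -/
theorem sparseNearPlateauStability :
    ∀ A : ℕ → ℝ, (∀ j, 1 ≤ A j) → ∀ N₀ : ℝ, 0 < N₀ → ∃ c₀ r : ℝ, 0 < c₀ ∧ 0 < r ∧ ∀ δ : ℝ, 0 < δ → ∃ ε : ℝ, 0 < ε ∧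
      ∀ (v : E3 → E3) (M B : ℝ), IsAdm v M B → IsReg A v M → Wpa v * lam v ≤ N₀ * M ^ 2 →
        0 < M * Real.sqrt (Zen v) * Real.sqrt (Wpa v) →
        (kStar - ε) * M * Real.sqrt (Zen v) * Real.sqrt (Wpa v) ≤ |Jst v| →
          ∃ x₀ : E3, ENNReal.ofReal (c₀ * (r * lam v) ^ 3) ≤
            volume {x : E3 | x ∈ Metric.ball x₀ (r * lam v) ∧ (1 - δ) * M ≤ ‖v x‖} := by
  intro A hA N₀ hN₀
  classical
  have hk : 0 < kStar := kStar_pos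
  obtain ⟨C_G, hCG, hG⟩ := stub_densitySupBound A hA
  obtain ⟨m₀, hm₀⟩ := card_separated_halfTop_le (A₁ := A 1) (N₀ := N₀) (hA 1)
  have hA1 : 1 ≤ A 1 := hA 1
  set n₀ : ℝ := Real.pi / (16 * (‖curlCLM‖ + 1) * A 1) with hn₀def
  have hn₀ : 0 < n₀ := by rw [hn₀def]; have := norm_nonneg curlCLM; positivity
  obtain ⟨Ψ₀, hΨ₀, hTF⟩ := exists_topTestField A hA N₀ hn₀
  set ρ₀ : ℝ := 2 * 7 ^ m₀ with hρ₀def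
  have hρ₀ : 0 < ρ₀ := by rw [hρ₀def]; positivity
  set V₀ : ℝ := kStar ^ 2 * n₀ / (C_G * Ψ₀) with hV₀def
  have hV₀ : 0 < V₀ := by rw [hV₀def]; positivity
  refine ⟨V₀ / ((m₀ + 1) * ρ₀ ^ 3), ρ₀, by positivity, hρ₀, fun δ hδ => ?_⟩
  set δ' : ℝ := min δ (1 / 2) with hδ'def
  have hδ' : 0 < δ' := lt_min hδ (by norm_num)
  have hδ'2 : δ' ≤ 1 / 2 := min_le_right _ _
  have hδ'δ : δ' ≤ δ := min_le_left _ _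
  obtain ⟨Λ, σ₀, hΛ1, hσ₀, hσ₁, hηall⟩ := hTF δ' hδ' hδ'2
  have hb1 : 1 ≤ (2 * A 1 + 3) * Λ ^ 3 := by nlinarith [one_le_pow₀ (n := 3) hΛ1]
  obtain ⟨hε0, hεk2, hslack⟩ := slack_choice hk hb1 hΛ1 hσ₀
  refine ⟨_, hε0, ?_⟩
  intro v M B hadm hreg hsp hpos heff
  obtain ⟨hv, hdiv, hM, hB, h0, h1, h2⟩ := hadm
  -- non-degeneracy
  have hMpos : 0 < M := by
    by_contra h
    exact absurd hpos (not_lt.2 (mul_nonpos_of_nonpos_of_nonneg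
      (mul_nonpos_of_nonpos_of_nonneg (not_lt.1 h) (Real.sqrt_nonneg _)) (Real.sqrt_nonneg _)))
  have hsZpos : 0 < Real.sqrt (Zen v) := lt_of_le_of_ne (Real.sqrt_nonneg _) fun h => by rw [← h] at hpos; simp at hpos
  have hsWpos : 0 < Real.sqrt (Wpa v) := lt_of_le_of_ne (Real.sqrt_nonneg _) fun h => by rw [← h] at hpos; simp at hpos
  have hlampos : 0 < lam v := Real.sqrt_pos.2 (div_pos (Real.sqrt_pos.1 hsZpos) (Real.sqrt_pos.1 hsWpos))
  -- the cell floor, the test field, the density, the cover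
  have hlow : n₀ * M ^ 2 ≤ Wpa v * lam v := cell_floor hA1 ⟨hv, hdiv, hM, hB, h0, h1, h2⟩ hreg hpos hεk2 heff
  obtain ⟨η, hηs, hηc, hsupp, hsup, hshrink, hDφ, hZφ, hWφ⟩ := hηall v M B ⟨hv, hdiv, hM, hB, h0, h1, h2⟩ hreg hsp hlow hpos
  obtain ⟨G, hGd, hGsup⟩ := hG v M B ⟨hv, hdiv, hM, hB, h0, h1, h2⟩ hreg hpos
  have hD1 : ∀ x, ‖iteratedFDeriv ℝ 1 v x‖ ≤ A 1 * M * (lam v)⁻¹ := fun x => by simpa using hreg 1 x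
  have hbound := hm₀ v M B ⟨hv, hdiv, hM, hB, h0, h1, h2⟩ hD1 hsp hpos
  obtain ⟨k, c, ρ, hkm, -, hρ, hcov, -⟩ := exists_cluster_cover {x : E3 | M / 2 ≤ ‖v x‖} hlampos m₀ hbound
  -- the near-top set `T`
  set T : Set E3 := {x : E3 | (1 - 3 * δ' / 4) * M ≤ ‖v x‖} with hTdef
  have hThalf : T ⊆ {x : E3 | M / 2 ≤ ‖v x‖} := fun x hx => by
    have h' : (1 - 3 * δ' / 4) * M ≤ ‖v x‖ := hx
    have : M / 2 ≤ (1 - 3 * δ' / 4) * M := by nlinarith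
    exact this.trans h'
  have hTcov : T ⊆ ⋃ i, ball (c i) (ρ i) := hThalf.trans hcov
  have hTfin : volume T ≠ ⊤ := by
    refine ne_top_of_le_ne_top ?_ (measure_mono hTcov)
    refine ne_top_of_le_ne_top ?_ (measure_iUnion_fintype_le volume _)
    exact (ENNReal.sum_lt_top.2 fun i _ => measure_ball_lt_top).ne
  have hV := topVolume_lower_of_testField ⟨hv, hdiv, hM, hB, h0, h1, h2⟩ hA1 hD1 hpos hε0.le (by linarith) heff hΛ1 hσ₀ hσ₁
    hslack hηs hηc hsupp hsup hΨ₀ hshrink hDφ hZφ hWφ hGd hCG hGsup hlow hTfin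
  -- pigeonhole over the cluster balls
  have hpiece : ((m₀ + 1 : ℕ) : ℝ≥0∞) * ENNReal.ofReal (V₀ * lam v ^ 3 / (m₀ + 1)) ≤ volume T := by
    rw [show ((m₀ + 1 : ℕ) : ℝ≥0∞) = ENNReal.ofReal ((m₀ : ℝ) + 1) by
        rw [ENNReal.ofReal_add (Nat.cast_nonneg _) zero_le_one]; simp,
      ← ENNReal.ofReal_mul (by positivity), show ((m₀ : ℝ) + 1) * (V₀ * lam v ^ 3 / (m₀ + 1)) = V₀ * lam v ^ 3 by
        field_simp]
    exact ENNReal.ofReal_le_of_le_toReal hV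
  obtain ⟨i, hi⟩ := exists_piece_volume_ge hkm T (fun i => ball (c i) (ρ i)) hTcov _ (by positivity)
    ENNReal.ofReal_ne_top hpiece
  refine ⟨c i, ?_⟩
  have hsub : T ∩ ball (c i) (ρ i) ⊆ {x : E3 | x ∈ ball (c i) (ρ₀ * lam v) ∧ (1 - δ) * M ≤ ‖v x‖} := by
    intro x hx
    refine ⟨ball_subset_ball (hρ i).2 hx.2, le_trans ?_ hx.1⟩
    exact mul_le_mul_of_nonneg_right (by linarith) hMpos.le
  calc ENNReal.ofReal (V₀ / ((m₀ + 1) * ρ₀ ^ 3) * (ρ₀ * lam v) ^ 3) = ENNReal.ofReal (V₀ * lam v ^ 3 / (m₀ + 1)) := by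
        congr 1; field_simp
    _ ≤ volume (T ∩ ball (c i) (ρ i)) := hi
    _ ≤ volume {x : E3 | x ∈ ball (c i) (ρ₀ * lam v) ∧ (1 - δ) * M ≤ ‖v x‖} := measure_mono hsub

end DepletionLadder.KStar.BangBang

end Summit.NavierStokesRegularity.NavierStokesRegularity.Theorems

end
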